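import Mathlib
import HarnessLib
import Literature.Analysis.FluidPDE.GigaMiura2011LocalCriterion
import Literature.Analysis.FluidPDE.LocalTypeIBlowup.CurlLimit
import Literature.Analysis.FluidPDE.GigaMiura2011ScaledAlignmentBlowupLimitHolds
import Literature.Analysis.FluidPDE.LocalTypeIWeakSerrinProofs
import Literature.Analysis.FluidPDE.CurlFreeLiouville
import Literature.Analysis.FluidPDE.LocalTypeILiouville

/-!
# Giga–Miura 2011, Theorem 2.10 (local continuous-alignment Type I criterion): discharge

Analysis/FluidPDE proof file (theorems only: no definition, no named fact, no `sorry`):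
`gigaMiura2011_local_continuousAlignment_typeI_holds` proves the named fact
`gigaMiura2011_local_continuousAlignment_typeI` of `GigaMiura2011LocalCriterion.lean`
(Giga–Miura 2011, CMP 303 §2.2, **Theorem 2.10**, HUPS preprint #956 p. 10: a suitable weak
solution of Navier–Stokes in `Q(0, 1)`, `C¹` in space near the vertex, with the local Type I rate
`√(−t)|u(x,t)| ≤ C₀` and the continuous-alignment condition (D) with a modulus `η` on
`B(0, r₀) × (−1, 0)`, is bounded in some parabolic neighbourhood of the vertex). The paper proves
it by **Remark 2.11** (p. 11): "We do not prove Theorem 2.10 because it is almost parallel as the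
proof of Theorem 1.1. The only difference is the compactness argument which justifies convergence
of sequences of the rescaled local solutions. For the purpose we invoke a result in Seregin and
Sverak [SS, Theorem 2.8], which says that the rescaled solutions constructed by same way as in
Section 2.1 are Hölder continuous locally uniformly in `ℝ³ × (−∞, 0]`, and then the subsequence
converges to some backward global mild solution `u` locally uniformly in `ℝ³ × (−∞, 0]`" — i.e.
the argument of Theorem 1.1 / Prop. 2.2 (§2.1 pp. 6–8) run on the Seregin–Šverák local Type I
blow-up limit. That is the proof formalised here, in the tree's vocabulary:

1. *Local Type I from the rate* (Albritton–Barker 2019, Lemma 2.5 / Rmk 3.2, PROVED in the tree as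
   `albrittonBarker2019_lemma_2_5_rate_holds`): after the parabolic zoom by `r₀` the rate holds on
   `Q(0, 1)`, so `𝐈(Q(0, 1/2)) < ∞`; a second zoom by `1/2` gives a suitable weak solution `u₂` in
   `Q(0, 1)` with `𝐈(Q(0, 1)) < ∞`, `C¹` slices, and — arguing by contradiction — a backward
   singular vertex (`eLpNorm_top_nsZoom`).
2. *Blow-up with vorticity convergence* (Seregin–Šverák 2009, Thm 2.8 in `C¹_loc` form:
   `LocalTypeIBlowup.exists_oseenMild_blowupLimit_curl`, files `CurlCompactness`, `CurlLimit`): a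
   continuous, weakly divergence-free, Oseen-mild ancient field `Vo` bounded by `1`, suitable,
   `𝐈 < ∞`, non-trivial, and zoom data `Λ_j → 0`, `T_j`, `X_j` with
   `Λ_j² curl u₂(T_j + Λ_j² s)(X_j + Λ_j y) → curl Vo(s)(y)` for a.e. `s < 0` and all `y`; composed
   with the two zooms (`curl_smul_stPull`) this is a zoom of `u` itself by `Λ'_j = r₀Λ_j/2`, with
   physical points in `(−1, 0) × B(0, r₀)`.
3. *(D) along the zoom* (GM11 p. 7, first step of the proof of Prop. 2.2;
   `dir_eq_of_continuousAlignment_localZoom`): where `curl Vo(s) ≠ 0` at two points the physical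
   vorticities exceed the level `d` eventually and their distance is `Λ'_j|y − y'| → 0`, so (D) and
   `η(0) = 0`, `η` continuous, force equal directions; `dir_eq_all_of_ae` extends this from a.e.
   `s` to every `s < 0` by the joint continuity of `curl Vo` (the limit is smooth:
   `smooth_and_bounds_of_bounded_ancient_oseenMild`, KNSS Prop. 4.1), and
   `exists_eq_norm_smul_of_dir_eq` writes `curl Vo(s) = |curl Vo(s)| ζ₀(s)`.
4. *Rigidity* (GM11 Prop. 2.2, proved core `gigaMiura2011_unidirectional_vorticity_eq_zero_holds`:
   2D reduction + Lemma 2.3 / KNSS Thm 5.1): `curl Vo ≡ 0`; each slice is then a bounded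
   irrotational incompressible `C²` field, hence constant
   (`eq_of_curl_eq_zero_of_isDivFree_of_bounded`, KNSS Lemma 3.1), which contradicts `𝐈 < ∞` and
   non-triviality (`not_ae_slice_const_of_abTypeIBound`, Albritton–Barker §1).

Deviation from print, stated: the paper's blow-up limit is taken in `L^∞`-normalised variables
around near-maximum points (pp. 5–6); the tree's Seregin–Šverák/Albritton–Barker engine picks
points by the CKN `ε`-regularity threshold instead (file `Approximants`), which yields the same kind
of limit (bounded, mild, ancient, non-trivial) — all that Remark 2.11 takes from [SS, Theorem 2.8]
("the subsequence converges to some backward global mild solution `u` locally uniformly"). Nothing here is a claim about Navier–Stokes regularity in general; no new notion and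
no new named fact is introduced (net debt −1).

## References

* Y. Giga, H. Miura, *On vorticity directions near singularities for the Navier–Stokes flows with
  infinite energy*, Comm. Math. Phys. 303 (2011) 289–300 = HUPS preprint #956: §2.1 (pp. 5–6,
  Prop. 2.2 pp. 7–8), §2.2 Def. 2.9 and Thm 2.10 (p. 10), Rmk 2.11 (p. 11). [GigaMiura2011]
* G. Seregin, V. Šverák, Comm. PDE 34 (2009) = arXiv:0804.1803, Thm 2.8 (p. 7). [SereginSverak2009]
* D. Albritton, T. Barker, J. Math. Fluid Mech. 21 (2019) = arXiv:1811.00502, Lemma 2.5, Rmk 3.2,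
  §1, §3. [AlbrittonBarker2019]
* G. Koch, N. Nadirashvili, G. Seregin, V. Šverák, Acta Math. 203 (2009) = arXiv:0709.3599,
  Lemma 3.1, Prop. 4.1, Thm 5.1, Lemma 6.1. [KochNadirashviliSereginSverak2009]
-/

noncomputable section

open MeasureTheory Set Function Filter Topology TopologicalSpace Metric
open scoped NNReal ENNReal
open Literature.Analysis Literature.Analysis.FluidPDE Literature.Analysis.FluidPDE.LocalTypeIBlowup

namespace Literature.Analysis.FluidPDE

/-! ### Step D: continuous alignment passes to the blow-up limit (a.e. slice) -/

/-- **(CA) along a parabolic zoom at a local Type I singular point forces a single vorticity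
direction on the limit slice** (Giga–Miura 2011, proof of Prop. 2.2, first step, HUPS #956 p. 7:
"we argue in the same way [as Thm 1.1] to observe that (`u_k`, `ω_k`) converges to (`ū`, `ω̄`) …
Since we assume (CA′) we see … `ω̄(x,t) = |ω̄(x,t)| ζ₀(t)`", in the local frame of Theorem 2.10:
the modulus is applied to the physical distance `Λ_j |y − y'| → 0` directly). If the zoomed
vorticities `Λ_j² curl u(T_j + Λ_j² s)(X_j + Λ_j y)` converge to `Ω(y)` for every `y`, with
`Λ_j → 0` and the physical points inside `(−1, 0) × B(0, r₀)` eventually, and `u` satisfies (CA)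
with level `d` and modulus `η` (continuous on `[0, ∞)`, `η(0) = 0`) there, then `Ω` has the same
direction at any two points where it is non-zero. [cite: GigaMiura2011, Prop. 2.2 proof, first step (HUPS preprint #956 p. 7), as used for Thm 2.10 (Rmk 2.11)] -/
theorem dir_eq_of_continuousAlignment_localZoom
    {u : ℝ → EuclideanSpace ℝ (Fin 3) → EuclideanSpace ℝ (Fin 3)} {d r₀ : ℝ} {η : ℝ → ℝ}
    (hd : 0 < d) (hηc : ContinuousOn η (Ici 0)) (hη0 : η 0 = 0)
    (hmod : ∀ t ∈ Ioo (-1 : ℝ) 0, ∀ x ∈ ball (0 : EuclideanSpace ℝ (Fin 3)) r₀,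
      ∀ x' ∈ ball (0 : EuclideanSpace ℝ (Fin 3)) r₀,
      d < ‖curl (u t) x‖ → d < ‖curl (u t) x'‖ →
        ‖vorticityDirection (curl (u t)) x - vorticityDirection (curl (u t)) x'‖ ≤ η ‖x - x'‖)
    {Λ T : ℕ → ℝ} {X : ℕ → EuclideanSpace ℝ (Fin 3)} {s : ℝ}
    {Ω : EuclideanSpace ℝ (Fin 3) → EuclideanSpace ℝ (Fin 3)}
    (hΛ : ∀ j, 0 < Λ j) (hΛ0 : Tendsto Λ atTop (𝓝 0))
    (hbox : ∀ y, ∀ᶠ j in atTop,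
      T j + Λ j ^ 2 * s ∈ Ioo (-1 : ℝ) 0 ∧ X j + Λ j • y ∈ ball (0 : EuclideanSpace ℝ (Fin 3)) r₀)
    (hconv : ∀ y, Tendsto (fun j => Λ j ^ 2 • curl (u (T j + Λ j ^ 2 * s)) (X j + Λ j • y)) atTop
      (𝓝 (Ω y))) :
    ∀ y y', Ω y ≠ 0 → Ω y' ≠ 0 → ‖Ω y‖⁻¹ • Ω y = ‖Ω y'‖⁻¹ • Ω y' := by
  intro y y' hy hy'
  -- shorthand: physical points, vorticities and the positive scaling factor
  set Pt : ℕ → EuclideanSpace ℝ (Fin 3) := fun j => X j + Λ j • y with hPt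
  set Pt' : ℕ → EuclideanSpace ℝ (Fin 3) := fun j => X j + Λ j • y' with hPt'
  set a : ℕ → EuclideanSpace ℝ (Fin 3) := fun j => curl (u (T j + Λ j ^ 2 * s)) (Pt j) with ha
  set b : ℕ → EuclideanSpace ℝ (Fin 3) := fun j => curl (u (T j + Λ j ^ 2 * s)) (Pt' j) with hb
  have hcpos : ∀ j, 0 < Λ j ^ 2 := fun j => pow_pos (hΛ j) 2
  have hca : Tendsto (fun j => (Λ j ^ 2) • a j) atTop (𝓝 (Ω y)) := hconv y
  have hcb : Tendsto (fun j => (Λ j ^ 2) • b j) atTop (𝓝 (Ω y')) := hconv y'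
  -- normalisation: continuous at non-zero limits, invariant under positive scaling
  have hdir : ∀ (v : ℕ → EuclideanSpace ℝ (Fin 3)) (z : EuclideanSpace ℝ (Fin 3)), z ≠ 0 →
      Tendsto (fun j => (Λ j ^ 2) • v j) atTop (𝓝 z) →
      Tendsto (fun j => ‖v j‖⁻¹ • v j) atTop (𝓝 (‖z‖⁻¹ • z)) := by
    intro v z hz hv
    have h1 : Tendsto (fun j => ‖(Λ j ^ 2) • v j‖⁻¹ • ((Λ j ^ 2) • v j)) atTop
        (𝓝 (‖z‖⁻¹ • z)) := ((hv.norm).inv₀ (norm_ne_zero_iff.mpr hz)).smul hv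
    refine h1.congr fun j => ?_
    rw [norm_smul, Real.norm_of_nonneg (hcpos j).le, mul_inv, smul_smul, mul_comm (Λ j ^ 2)⁻¹,
      mul_assoc, inv_mul_cancel₀ (hcpos j).ne', mul_one]
  have hda := hdir a (Ω y) hy hca
  have hdb := hdir b (Ω y') hy' hcb
  -- the chord of the directions converges to the chord of the limit directions
  have hchord : Tendsto (fun j => ‖‖a j‖⁻¹ • a j - ‖b j‖⁻¹ • b j‖) atTop
      (𝓝 ‖‖Ω y‖⁻¹ • Ω y - ‖Ω y'‖⁻¹ • Ω y'‖) := (hda.sub hdb).norm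
  -- the scaling factor tends to zero, so the physical vorticities exceed the level `d` eventually
  have hc0 : Tendsto (fun j => Λ j ^ 2) atTop (𝓝 0) := by
    have h := hΛ0.pow 2
    rwa [zero_pow two_ne_zero] at h
  have hlarge : ∀ (v : ℕ → EuclideanSpace ℝ (Fin 3)) (z : EuclideanSpace ℝ (Fin 3)), z ≠ 0 →
      Tendsto (fun j => (Λ j ^ 2) • v j) atTop (𝓝 z) → ∀ᶠ j in atTop, d < ‖v j‖ := by
    intro v z hz hv
    have hzpos : 0 < ‖z‖ := norm_pos_iff.mpr hz
    have h1 : ∀ᶠ j in atTop, ‖z‖ / 2 < ‖(Λ j ^ 2) • v j‖ :=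
      (hv.norm).eventually_const_lt (by linarith)
    have h2 : ∀ᶠ j in atTop, Λ j ^ 2 < ‖z‖ / (2 * (d + 1)) :=
      hc0.eventually_lt_const (by positivity)
    filter_upwards [h1, h2] with j h1j h2j
    rw [norm_smul, Real.norm_of_nonneg (hcpos j).le] at h1j
    by_contra hle
    push Not at hle
    have h3 : Λ j ^ 2 * ‖v j‖ ≤ ‖z‖ / (2 * (d + 1)) * d :=
      mul_le_mul h2j.le hle (norm_nonneg _) (by positivity)
    have h4 : ‖z‖ / (2 * (d + 1)) * d < ‖z‖ / 2 := by
      rw [div_mul_eq_mul_div, div_lt_div_iff₀ (by positivity) (by positivity)]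
      nlinarith
    linarith
  have hea := hlarge a (Ω y) hy hca
  have heb := hlarge b (Ω y') hy' hcb
  -- the argument `Λ_j |y − y'|` of the modulus tends to `0` within `[0, ∞)`
  set L : ℝ := ‖y - y'‖ with hL
  have hL0 : 0 ≤ L := norm_nonneg _
  have harg : Tendsto (fun j => Λ j * L) atTop (𝓝[≥] 0) := by
    refine tendsto_nhdsWithin_iff.2 ⟨?_, Eventually.of_forall fun j => mul_nonneg (hΛ j).le hL0⟩
    have h := hΛ0.mul_const L
    rwa [zero_mul] at h
  have hηlim : Tendsto (fun j => η (Λ j * L)) atTop (𝓝 0) := by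
    have hcont : ContinuousWithinAt η (Ici 0) 0 := hηc 0 (mem_Ici.2 le_rfl)
    have h := hcont.tendsto.comp harg
    rwa [hη0] at h
  -- (CA) at the two physical points, rewritten in zoom variables
  have hbound : ∀ᶠ j in atTop, ‖‖a j‖⁻¹ • a j - ‖b j‖⁻¹ • b j‖ ≤ η (Λ j * L) := by
    filter_upwards [hea, heb, hbox y, hbox y'] with j hja hjb hjy hjy'
    have hms := hmod (T j + Λ j ^ 2 * s) hjy.1 (Pt j) hjy.2 (Pt' j) hjy'.2 hja hjb
    rw [vorticityDirection_apply, vorticityDirection_apply] at hms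
    have hdist : ‖Pt j - Pt' j‖ = Λ j * L := by
      have e : Pt j - Pt' j = Λ j • (y - y') := by
        simp only [hPt, hPt', smul_sub]; abel
      rw [e, norm_smul, Real.norm_of_nonneg (hΛ j).le]
    rw [hdist] at hms
    exact hms
  -- pass to the limit: the chord of the limit directions is `≤ 0`
  have hle : ‖‖Ω y‖⁻¹ • Ω y - ‖Ω y'‖⁻¹ • Ω y'‖ ≤ 0 :=
    le_of_tendsto_of_tendsto hchord hηlim hbound
  have h0 : ‖‖Ω y‖⁻¹ • Ω y - ‖Ω y'‖⁻¹ • Ω y'‖ = 0 := le_antisymm hle (norm_nonneg _)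
  rw [norm_eq_zero, sub_eq_zero] at h0
  have _ := hd
  exact h0

/-! ### Step E: from a.e. slice to every slice (continuity of the limit vorticity) -/

/-- **Closure in time of the single-direction property.** If `Ω : ℝ → ℝ³ → ℝ³` is jointly
continuous on the open slab `(−∞, 0) × ℝ³` and for a.e. `s < 0` the slice `Ω(s, ·)` has one
direction wherever it is non-zero, then EVERY slice `s < 0` does (the good times are dense, and
the normalised field is continuous at points where `Ω ≠ 0`). [cite: GigaMiura2011, Prop. 2.2 proof, first step (HUPS preprint #956 p. 7: "ω̄(x,t) = |ω̄(x,t)| ζ₀(t)" for all t)] -/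
theorem dir_eq_all_of_ae {Ω : ℝ → EuclideanSpace ℝ (Fin 3) → EuclideanSpace ℝ (Fin 3)}
    (hΩc : ContinuousOn (uncurry Ω) (Iio 0 ×ˢ univ))
    (hae : ∀ᵐ s ∂(volume.restrict (Iio (0 : ℝ))), ∀ y y', Ω s y ≠ 0 → Ω s y' ≠ 0 →
      ‖Ω s y‖⁻¹ • Ω s y = ‖Ω s y'‖⁻¹ • Ω s y') :
    ∀ s < 0, ∀ y y', Ω s y ≠ 0 → Ω s y' ≠ 0 → ‖Ω s y‖⁻¹ • Ω s y = ‖Ω s y'‖⁻¹ • Ω s y' := by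
  intro s₀ hs₀ y y' hy hy'
  -- the good set of times is dense
  set A : Set ℝ := {s | s ∈ Iio (0 : ℝ) → ∀ y y', Ω s y ≠ 0 → Ω s y' ≠ 0 →
    ‖Ω s y‖⁻¹ • Ω s y = ‖Ω s y'‖⁻¹ • Ω s y'} with hA
  have hAae : ∀ᵐ s ∂(volume : Measure ℝ), s ∈ A := (ae_restrict_iff' measurableSet_Iio).1 hae
  have hAd : Dense A := Measure.dense_of_ae hAae
  have hmem : s₀ ∈ closure (Iio 0 ∩ A) :=
    isOpen_Iio.inter_closure ⟨hs₀, hAd.closure_eq ▸ mem_univ s₀⟩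
  have hne : (𝓝[Iio 0 ∩ A] s₀).NeBot := mem_closure_iff_nhdsWithin_neBot.1 hmem
  -- time lines of `Ω` are continuous within `Iio 0`
  have hline : ∀ x, ContinuousWithinAt (fun s => Ω s x) (Iio 0) s₀ := fun x =>
    (hΩc.comp (continuous_id.prodMk continuous_const).continuousOn
      (fun s hs => ⟨hs, mem_univ _⟩)) s₀ hs₀
  set F : ℝ → EuclideanSpace ℝ (Fin 3) := fun s =>
    ‖Ω s y‖⁻¹ • Ω s y - ‖Ω s y'‖⁻¹ • Ω s y' with hF
  have hFc : ContinuousWithinAt F (Iio 0) s₀ :=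
    ((((hline y).norm).inv₀ (norm_ne_zero_iff.2 hy)).smul (hline y)).sub
      ((((hline y').norm).inv₀ (norm_ne_zero_iff.2 hy')).smul (hline y'))
  have h1 : Tendsto F (𝓝[Iio 0 ∩ A] s₀) (𝓝 (F s₀)) :=
    hFc.tendsto.mono_left (nhdsWithin_mono _ inter_subset_left)
  -- along good times near `s₀` the chord vanishes
  have hevy : ∀ᶠ s in 𝓝[Iio 0 ∩ A] s₀, Ω s y ≠ 0 :=
    ((hline y).tendsto.eventually_ne hy).filter_mono (nhdsWithin_mono _ inter_subset_left)
  have hevy' : ∀ᶠ s in 𝓝[Iio 0 ∩ A] s₀, Ω s y' ≠ 0 :=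
    ((hline y').tendsto.eventually_ne hy').filter_mono (nhdsWithin_mono _ inter_subset_left)
  have h2 : Tendsto F (𝓝[Iio 0 ∩ A] s₀) (𝓝 0) := by
    refine tendsto_const_nhds.congr' ?_
    filter_upwards [hevy, hevy', self_mem_nhdsWithin] with s h1s h2s hs
    show (0 : EuclideanSpace ℝ (Fin 3)) = F s
    rw [hF]
    exact (sub_eq_zero.2 (hs.2 hs.1 y y' h1s h2s)).symm
  have h3 : F s₀ = 0 := by
    haveI := hne
    exact tendsto_nhds_unique h1 h2
  exact sub_eq_zero.1 h3


/-! ### The theorem -/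

/-- **Giga–Miura 2011, Theorem 2.10, PROVED** — discharge of the named fact
`gigaMiura2011_local_continuousAlignment_typeI` (HUPS #956 p. 10 = CMP 303 §2.2: a suitable weak
solution in `Q(0, 1)`, `C¹` in space near the vertex, with the local Type I rate
`√(−t)|u| ≤ C₀` and the continuous-alignment condition (D) on `B(0, r₀) × (−1, 0)`, is bounded
near the vertex; Remark 2.11, p. 11: "we invoke a result in Seregin and Sverak [SS, Theorem 2.8]
… and then the subsequence converges to some backward global mild solution `u` locally uniformly
in `ℝ³ × (−∞, 0]`"). Proof, following Remark 2.11 (module docstring): if the vertex were singular, Albritton–Barker's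
Lemma 2.5 (`albrittonBarker2019_lemma_2_5_rate_holds`, from the rate) makes it a local Type I
singular point of the zoom `u₂` of `u` by `r₀/2`; the blow-up procedure with vorticity
convergence (`LocalTypeIBlowup.exists_oseenMild_blowupLimit_curl`) yields a non-trivial bounded
Oseen-mild ancient limit `Vo` with `𝐈 < ∞` and `Λ_j² curl u(T_j + Λ_j² s)(X_j + Λ_j y) →
curl Vo(s)(y)` for a.e. `s`; (D) forces one vorticity direction per slice
(`dir_eq_of_continuousAlignment_localZoom`, `dir_eq_all_of_ae`, `exists_eq_norm_smul_of_dir_eq`);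
the proved core of Prop. 2.2 (`gigaMiura2011_unidirectional_vorticity_eq_zero_holds`) gives
`curl Vo ≡ 0`, so every slice of `Vo` is a bounded irrotational incompressible field, hence
constant (`eq_of_curl_eq_zero_of_isDivFree_of_bounded`), contradicting `𝐈 < ∞` and
non-triviality (`not_ae_slice_const_of_abTypeIBound`). [cite: GigaMiura2011, Thm 2.10 (p. 10) and Rmk 2.11 (p. 11) (§2.2; HUPS preprint #956)] -/
theorem gigaMiura2011_local_continuousAlignment_typeI_holds :
    gigaMiura2011_local_continuousAlignment_typeI := by
  intro u p r₀ C₀ hball hr₀ hr₁ _ hC1 hrate hCA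
  obtain ⟨d, hd, η, -, hηc, hη0, hmod⟩ := hCA
  by_contra hcon
  push Not at hcon
  have hsing : IsBackwardSingularPoint u ((0 : ℝ), (0 : EuclideanSpace ℝ (Fin 3))) :=
    fun r hr => top_le_iff.mp (hcon r hr)
  -- ## Step 1: zoom by `r₀` to the unit ball; Lemma 2.5 from the Type I rate
  have hball0 : IsSuitableWeakSolutionInBall 1 (0 : ℝ × EuclideanSpace ℝ (Fin 3)) u p := hball
  have hballr : IsSuitableWeakSolutionInBall r₀ (0 : ℝ × EuclideanSpace ℝ (Fin 3)) u p :=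
    SuitableCompactness.isSuitableWeakSolutionInBall_of_le_radius hball0 hr₀ hr₁.le
  set ut : ℝ → EuclideanSpace ℝ (Fin 3) → EuclideanSpace ℝ (Fin 3) :=
    r₀ • stPull (r₀ ^ 2) r₀ 0 0 u with hut
  set pt : ℝ → EuclideanSpace ℝ (Fin 3) → ℝ := r₀ ^ 2 • stPull (r₀ ^ 2) r₀ 0 0 p with hpt
  have hball1 : IsSuitableWeakSolutionInBall 1 (0 : ℝ × EuclideanSpace ℝ (Fin 3)) ut pt := by
    have h := hballr.zoom hr₀
    simpa only [Prod.fst_zero, Prod.snd_zero] using h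
  obtain ⟨G₁, hG₁, -⟩ := hball1.2.2.1
  have hrate1 : ∀ t' x', (t', x') ∈ parabolicCylinder 1 (0 : ℝ × EuclideanSpace ℝ (Fin 3)) →
      ‖ut t' x'‖ ≤ C₀ / Real.sqrt ((0 : ℝ × EuclideanSpace ℝ (Fin 3)).1 - t') := by
    intro t' x' hmem
    rw [mem_parabolicCylinder] at hmem
    simp only [Prod.fst_zero, Prod.snd_zero, zero_sub, one_pow, dist_zero_right] at hmem
    obtain ⟨⟨ht1, ht0⟩, hx1⟩ := hmem
    have ht' : 0 < -t' := by linarith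
    have hτ : r₀ ^ 2 * t' ∈ Ioo (-1 : ℝ) 0 := by
      have h1 : r₀ ^ 2 < 1 := by nlinarith
      constructor
      · nlinarith [mul_pos (sub_pos.2 h1) ht']
      · exact mul_neg_of_pos_of_neg (pow_pos hr₀ 2) ht0
    have hξ : r₀ • x' ∈ ball (0 : EuclideanSpace ℝ (Fin 3)) r₀ := by
      rw [mem_ball_zero_iff, norm_smul, Real.norm_of_nonneg hr₀.le]
      nlinarith [norm_nonneg x']
    have h := hrate _ hτ _ hξ
    have hsq : Real.sqrt (-(r₀ ^ 2 * t')) = r₀ * Real.sqrt (-t') := by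
      rw [show -(r₀ ^ 2 * t') = r₀ ^ 2 * (-t') by ring, Real.sqrt_mul (sq_nonneg _),
        Real.sqrt_sq hr₀.le]
    rw [hsq] at h
    have hspos : 0 < Real.sqrt (-t') := Real.sqrt_pos.2 ht'
    simp only [Prod.fst_zero, zero_sub]
    show ‖(r₀ • stPull (r₀ ^ 2) r₀ 0 0 u) t' x'‖ ≤ C₀ / Real.sqrt (-t')
    rw [smul_stPull_apply, zero_add, zero_add, norm_smul, Real.norm_of_nonneg hr₀.le,
      le_div_iff₀ hspos]
    calc r₀ * ‖u (r₀ ^ 2 * t') (r₀ • x')‖ * Real.sqrt (-t')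
        = r₀ * Real.sqrt (-t') * ‖u (r₀ ^ 2 * t') (r₀ • x')‖ := by ring
      _ ≤ C₀ := h
  have hIhalf : typeIBound (parabolicCylinder (1 / 2) (0 : ℝ × EuclideanSpace ℝ (Fin 3))) ut pt G₁ < ⊤ :=
    albrittonBarker2019_lemma_2_5_rate_holds 0 ut pt C₀ hball1 hrate1 G₁ hG₁ (1 / 2)
      (by norm_num) (by norm_num)
  -- ## Step 2: zoom by `1/2`: a local Type I singular vertex in the unit ball
  have hballh : IsSuitableWeakSolutionInBall (1 / 2) (0 : ℝ × EuclideanSpace ℝ (Fin 3)) ut pt :=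
    SuitableCompactness.isSuitableWeakSolutionInBall_of_le_radius hball1 (by norm_num) (by norm_num)
  set u₂ : ℝ → EuclideanSpace ℝ (Fin 3) → EuclideanSpace ℝ (Fin 3) :=
    (1 / 2 : ℝ) • stPull ((1 / 2 : ℝ) ^ 2) (1 / 2) 0 0 ut with hu₂
  set p₂ : ℝ → EuclideanSpace ℝ (Fin 3) → ℝ :=
    (1 / 2 : ℝ) ^ 2 • stPull ((1 / 2 : ℝ) ^ 2) (1 / 2) 0 0 pt with hp₂
  set G₂ : ℝ → EuclideanSpace ℝ (Fin 3) → EuclideanSpace ℝ (Fin 3) →L[ℝ] EuclideanSpace ℝ (Fin 3) :=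
    ((1 / 2 : ℝ) * (1 / 2)) • stPull ((1 / 2 : ℝ) ^ 2) (1 / 2) 0 0 G₁ with hG₂
  have hball2 : IsSuitableWeakSolutionInBall 1 (0 : ℝ × EuclideanSpace ℝ (Fin 3)) u₂ p₂ := by
    have h := hballh.zoom (by norm_num : (0 : ℝ) < 1 / 2)
    simpa only [Prod.fst_zero, Prod.snd_zero] using h
  have hwg2 : HasWeakSpatialGradientOn (parabolicCylinderOpens 1 (0 : ℝ × EuclideanSpace ℝ (Fin 3))) u₂ G₂ := by
    have hle : parabolicCylinderOpens (1 / 2) (0 : ℝ × EuclideanSpace ℝ (Fin 3)) ≤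
        parabolicCylinderOpens 1 (0 : ℝ × EuclideanSpace ℝ (Fin 3)) :=
      parabolicCylinder_mono (by norm_num) (by norm_num) _
    have h := (hG₁.mono hle).stRescale (1 / 2 : ℝ) (β := (1 / 2 : ℝ) ^ 2) (γ := 1 / 2)
      (by norm_num) (by norm_num) (0 : ℝ × EuclideanSpace ℝ (Fin 3)).1 (0 : ℝ × EuclideanSpace ℝ (Fin 3)).2
    rw [zoom_stPreimage_parabolicCylinderOpens (by norm_num : (0 : ℝ) < 1 / 2)
      (0 : ℝ × EuclideanSpace ℝ (Fin 3))] at h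
    simpa only [Prod.fst_zero, Prod.snd_zero] using h
  have hI2 : typeIBound (parabolicCylinder 1 (0 : ℝ × EuclideanSpace ℝ (Fin 3))) u₂ p₂ G₂ =
      typeIBound (parabolicCylinder (1 / 2) (0 : ℝ × EuclideanSpace ℝ (Fin 3))) ut pt G₁ := by
    have h := typeIBound_nsZoom (c := (1 / 2 : ℝ)) (by norm_num) (0 : ℝ × EuclideanSpace ℝ (Fin 3)).1
      (0 : ℝ × EuclideanSpace ℝ (Fin 3)).2 (parabolicCylinder (1 / 2) (0 : ℝ × EuclideanSpace ℝ (Fin 3))) ut pt G₁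
    rw [zoom_preimage_parabolicCylinder_self (by norm_num : (0 : ℝ) < 1 / 2)
      (0 : ℝ × EuclideanSpace ℝ (Fin 3))] at h
    rw [← h]
    simp only [Prod.fst_zero, Prod.snd_zero, hG₂]
    congr 1
    norm_num
  have hI2top : typeIBound (parabolicCylinder 1 (0 : ℝ × EuclideanSpace ℝ (Fin 3))) u₂ p₂ G₂ < ⊤ := by
    rw [hI2]; exact hIhalf
  -- the vertex stays singular under both zooms
  have hst1 : stAffine (r₀ ^ 2) r₀ 0 0 (0 : ℝ × EuclideanSpace ℝ (Fin 3)) =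
      ((0 : ℝ), (0 : EuclideanSpace ℝ (Fin 3))) := by
    rw [show (0 : ℝ × EuclideanSpace ℝ (Fin 3)) = ((0 : ℝ), (0 : EuclideanSpace ℝ (Fin 3))) from rfl,
      stAffine_apply, mul_zero, add_zero, smul_zero, add_zero]
  have hsing1 : IsBackwardSingularPoint ut 0 := by
    intro r hr
    rw [hut, eLpNorm_top_nsZoom hr₀ 0 0 r 0 u, hst1, hsing (r₀ * r) (mul_pos hr₀ hr),
      ENNReal.mul_top (ENNReal.ofReal_pos.2 hr₀).ne']
  have hst2 : stAffine ((1 / 2 : ℝ) ^ 2) (1 / 2) 0 0 (0 : ℝ × EuclideanSpace ℝ (Fin 3)) = 0 := by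
    rw [show (0 : ℝ × EuclideanSpace ℝ (Fin 3)) = ((0 : ℝ), (0 : EuclideanSpace ℝ (Fin 3))) from rfl,
      stAffine_apply, mul_zero, add_zero, smul_zero, add_zero]
  have hsing2 : IsBackwardSingularPoint u₂ 0 := by
    intro r hr
    rw [hu₂, eLpNorm_top_nsZoom (by norm_num : (0 : ℝ) < 1 / 2) 0 0 r 0 ut, hst2,
      hsing1 ((1 / 2) * r) (by positivity),
      ENNReal.mul_top (ENNReal.ofReal_pos.2 (by norm_num : (0 : ℝ) < 1 / 2)).ne']
  -- `C¹` slices of `u₂` on the unit ball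
  have hC1₂ : ∀ t ∈ Ioo (-1 : ℝ) 0, ContDiffOn ℝ 1 (u₂ t) (ball (0 : EuclideanSpace ℝ (Fin 3)) 1) := by
    intro t ht
    have hτ : r₀ ^ 2 * ((1 / 2 : ℝ) ^ 2 * t) ∈ Ioo (-1 : ℝ) 0 := by
      obtain ⟨h1, h2⟩ := ht
      have hr2 : r₀ ^ 2 < 1 := by nlinarith
      constructor <;> nlinarith [pow_pos hr₀ 2]
    have hmaps : MapsTo (fun y : EuclideanSpace ℝ (Fin 3) => r₀ • ((1 / 2 : ℝ) • y))
        (ball (0 : EuclideanSpace ℝ (Fin 3)) 1) (ball (0 : EuclideanSpace ℝ (Fin 3)) r₀) := by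
      intro y hy
      rw [mem_ball_zero_iff] at hy ⊢
      rw [norm_smul, norm_smul, Real.norm_of_nonneg hr₀.le,
        Real.norm_of_nonneg (by norm_num : (0 : ℝ) ≤ 1 / 2)]
      nlinarith
    have hcomp : ContDiffOn ℝ 1 (fun y : EuclideanSpace ℝ (Fin 3) =>
        u (r₀ ^ 2 * ((1 / 2 : ℝ) ^ 2 * t)) (r₀ • ((1 / 2 : ℝ) • y))) (ball (0 : EuclideanSpace ℝ (Fin 3)) 1) :=
      (hC1 _ hτ).comp (by fun_prop : ContDiff ℝ 1
        (fun y : EuclideanSpace ℝ (Fin 3) => r₀ • ((1 / 2 : ℝ) • y))).contDiffOn hmaps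
    have he : u₂ t = fun y => (1 / 2 : ℝ) • (r₀ • u (r₀ ^ 2 * ((1 / 2 : ℝ) ^ 2 * t)) (r₀ • ((1 / 2 : ℝ) • y))) := by
      funext y
      show ((1 / 2 : ℝ) • stPull ((1 / 2 : ℝ) ^ 2) (1 / 2) 0 0 (r₀ • stPull (r₀ ^ 2) r₀ 0 0 u)) t y = _
      rw [smul_stPull_apply, smul_stPull_apply, zero_add, zero_add, zero_add, zero_add]
    rw [he]
    exact (hcomp.const_smul r₀).const_smul (1 / 2 : ℝ)
  -- ## Step 3: the blow-up limit with vorticity convergence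
  obtain ⟨Vo, P, H, Λ, T, X, hVoc, hVodiv, hVomild, hVoB, -, -, hVne, hVI, -, hΛpos, hΛ0, hboxj, hconv⟩ :=
    exists_oseenMild_blowupLimit_curl hball2 hwg2 hI2top hsing2 hC1₂
  -- ## Step 4: the zoom data in the frame of `u` (composition of the two zooms, factor `c = r₀/2`)
  set c : ℝ := r₀ / 2 with hc
  have hcpos : 0 < c := by positivity
  have hcurl2 : ∀ t x, curl (u₂ t) x = c ^ 2 • curl (u (c ^ 2 * t)) (c • x) := by
    intro t x
    show curl (((1 / 2 : ℝ) • stPull ((1 / 2 : ℝ) ^ 2) (1 / 2) 0 0 (r₀ • stPull (r₀ ^ 2) r₀ 0 0 u)) t) x = _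
    rw [curl_smul_stPull, curl_smul_stPull]
    simp only [zero_add, smul_smul]
    have e1 : (1 / 2 : ℝ) * (1 / 2) * (r₀ * r₀) = c ^ 2 := by rw [hc]; ring
    have e2 : r₀ ^ 2 * ((1 / 2 : ℝ) ^ 2 * t) = c ^ 2 * t := by rw [hc]; ring
    have e3 : r₀ * (1 / 2 : ℝ) = c := by rw [hc]; ring
    rw [e1, e2, e3]
  set Λ' : ℕ → ℝ := fun j => c * Λ j with hΛ'
  set T' : ℕ → ℝ := fun j => c ^ 2 * T j with hT'
  set X' : ℕ → EuclideanSpace ℝ (Fin 3) := fun j => c • X j with hX'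
  have hΛ'pos : ∀ j, 0 < Λ' j := fun j => mul_pos hcpos (hΛpos j)
  have hΛ'0 : Tendsto Λ' atTop (𝓝 0) := by
    have h := hΛ0.const_mul c
    rwa [mul_zero] at h
  have hident : ∀ j s y, Λ j ^ 2 • curl (u₂ (T j + Λ j ^ 2 * s)) (X j + Λ j • y) =
      Λ' j ^ 2 • curl (u (T' j + Λ' j ^ 2 * s)) (X' j + Λ' j • y) := by
    intro j s y
    rw [hcurl2, smul_smul]
    have e1 : Λ j ^ 2 * c ^ 2 = Λ' j ^ 2 := by simp only [hΛ']; ring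
    have e2 : c ^ 2 * (T j + Λ j ^ 2 * s) = T' j + Λ' j ^ 2 * s := by simp only [hΛ', hT']; ring
    have e3 : c • (X j + Λ j • y) = X' j + Λ' j • y := by
      simp only [hΛ', hX', smul_add, smul_smul]
    rw [e1, e2, e3]
  have hbox' : ∀ s < 0, ∀ y, ∀ᶠ j in atTop, T' j + Λ' j ^ 2 * s ∈ Ioo (-1 : ℝ) 0 ∧
      X' j + Λ' j • y ∈ ball (0 : EuclideanSpace ℝ (Fin 3)) r₀ := by
    intro s hs y
    filter_upwards [hboxj s hs y] with j hj
    obtain ⟨⟨h1, h2⟩, h3⟩ := hj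
    have hc1 : c < 1 := by rw [hc]; linarith
    have hc2 : 0 < c ^ 2 := pow_pos hcpos 2
    have hw : T' j + Λ' j ^ 2 * s = c ^ 2 * (T j + Λ j ^ 2 * s) := by simp only [hΛ', hT']; ring
    refine ⟨⟨?_, ?_⟩, ?_⟩
    · rw [hw]
      have hc3 : c ^ 2 < 1 := by nlinarith
      nlinarith [mul_pos hc2 (show 0 < T j + Λ j ^ 2 * s + 1 by linarith)]
    · rw [hw]; exact mul_neg_of_pos_of_neg hc2 h2
    · have hw' : X' j + Λ' j • y = c • (X j + Λ j • y) := by simp only [hΛ', hX', smul_add, smul_smul]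
      rw [hw', mem_ball_zero_iff, norm_smul, Real.norm_of_nonneg hcpos.le]
      have h4 := mem_ball_zero_iff.1 h3
      calc c * ‖X j + Λ j • y‖ ≤ c * 1 := by gcongr
        _ < r₀ := by rw [hc]; linarith
  have hconv' : ∀ᵐ s ∂(volume.restrict (Iio (0 : ℝ))), ∀ y,
      Tendsto (fun j => Λ' j ^ 2 • curl (u (T' j + Λ' j ^ 2 * s)) (X' j + Λ' j • y)) atTop
        (𝓝 (curl (Vo s) y)) := by
    filter_upwards [hconv] with s hs y
    simpa only [hident] using hs y
  -- ## Step 5: (D) gives one vorticity direction per slice of the limit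
  have hdir_ae : ∀ᵐ s ∂(volume.restrict (Iio (0 : ℝ))), ∀ y y', curl (Vo s) y ≠ 0 → curl (Vo s) y' ≠ 0 →
      ‖curl (Vo s) y‖⁻¹ • curl (Vo s) y = ‖curl (Vo s) y'‖⁻¹ • curl (Vo s) y' := by
    filter_upwards [hconv', ae_restrict_mem measurableSet_Iio] with s hs hs0
    exact dir_eq_of_continuousAlignment_localZoom hd hηc hη0 hmod hΛ'pos hΛ'0 (fun y => hbox' s hs0 y) hs
  obtain ⟨hVsm, hVD⟩ := smooth_and_bounds_of_bounded_ancient_oseenMild hVoc hVodiv hVomild hVoB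
  have hV1 : ContDiffOn ℝ 1 (uncurry Vo) (Iio 0 ×ˢ univ) := hVsm.of_le (by exact_mod_cast le_top)
  have hcurlc : ContinuousOn (uncurry fun s y => curl (Vo s) y) (Iio 0 ×ˢ univ) := by
    have h1 : ContinuousOn (fun q : ℝ × EuclideanSpace ℝ (Fin 3) => fderiv ℝ (Vo q.1) q.2) (Iio 0 ×ˢ univ) :=
      continuousOn_fderiv_slice_of_contDiffOn hV1 (uniqueDiffOn_Iio 0)
    have h2 : (uncurry fun s y => curl (Vo s) y) =
        (fun L : EuclideanSpace ℝ (Fin 3) →L[ℝ] EuclideanSpace ℝ (Fin 3) => curlCLM L) ∘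
          (fun q : ℝ × EuclideanSpace ℝ (Fin 3) => fderiv ℝ (Vo q.1) q.2) := by
      funext q
      rcases q with ⟨s, y⟩
      simp only [uncurry_apply_pair, comp_apply, curl_eq_curlCLM]
    rw [h2]
    exact curlCLM.continuous.comp_continuousOn h1
  have hdir_all := dir_eq_all_of_ae hcurlc hdir_ae
  have hζ : ∃ ζ₀ : ℝ → EuclideanSpace ℝ (Fin 3), ∀ t < 0, ∀ x, curl (Vo t) x = ‖curl (Vo t) x‖ • ζ₀ t := by
    have hch : ∀ t : ℝ, ∃ ζ : EuclideanSpace ℝ (Fin 3), t < 0 → ∀ x, curl (Vo t) x = ‖curl (Vo t) x‖ • ζ := by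
      intro t
      by_cases ht : t < 0
      · obtain ⟨ζ, hζ⟩ := exists_eq_norm_smul_of_dir_eq (hdir_all t ht)
        exact ⟨ζ, fun _ => hζ⟩
      · exact ⟨0, fun h => absurd h ht⟩
    choose ζ hζ using hch
    exact ⟨ζ, fun t ht x => hζ t ht x⟩
  -- ## Step 6: Proposition 2.2 (proved core): the limit is irrotational, hence slice-wise constant
  have hcurl0 : ∀ t < 0, ∀ x, curl (Vo t) x = 0 :=
    gigaMiura2011_unidirectional_vorticity_eq_zero_holds hVsm hVD hVodiv hVomild hζ
  have hconst : ∀ t < 0, ∃ b : EuclideanSpace ℝ (Fin 3), Vo t = fun _ => b := by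
    intro t ht
    have hsl : ContDiff ℝ (⊤ : ℕ∞) (Vo t) := contDiff_slice_of_contDiffOn hVsm ht
    have hsl2 : ContDiff ℝ 2 (Vo t) := hsl.of_le (by norm_cast)
    have hsl1 : ContDiff ℝ 1 (Vo t) := hsl.of_le (by exact_mod_cast le_top)
    have hdivc : VectorCalculus.IsDivFree (Vo t) := (hVodiv t ht).isDivFree_of_contDiff hsl1
    refine ⟨Vo t 0, funext fun x => ?_⟩
    exact eq_of_curl_eq_zero_of_isDivFree_of_bounded hsl2 (hcurl0 t ht) hdivc (fun x => hVoB t ht x) x 0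
  -- ## Step 7: contradiction with `𝐈 < ∞` and non-triviality
  have hjoint : AEStronglyMeasurable (uncurry Vo)
      (volume.restrict (Iio (0 : ℝ) ×ˢ (univ : Set (EuclideanSpace ℝ (Fin 3))))) :=
    hVoc.aestronglyMeasurable (measurableSet_Iio.prod MeasurableSet.univ)
  refine not_ae_slice_const_of_abTypeIBound hjoint hVne hVI ?_
  filter_upwards [ae_restrict_mem measurableSet_Iio] with t ht
  obtain ⟨b, hb⟩ := hconst t ht
  exact ⟨b, Eventually.of_forall fun x => by rw [hb]⟩

end Literature.Analysis.FluidPDE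

end
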